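import Summits.AtomisticToContinuum.Crystallization.Theorems.BraggSlacknessRigidityStrictCertificateFlatness

/-!
# Crux `StrictCertificate` (stmt-AtomisticToContinuum-13167, route `BraggSlacknessRigidity`):
# necessary conditions on a witness, IX — UNIFORM QUADRATIC SQUEEZE OF THE SLACK at every template distance

Support file for the line `registered` (lead c4); nothing here closes the item.  For a witness
`⟨P, ρ, c, g, U, f⟩` (any three-cone split of `V = V_LJ` attaining the periodic configuration `P`), a site
`p₀ ∈ P` with nearest-neighbour distance `ρ₁ > 0`, and the flatness constant
`2K = Σ'_{y ≠ p₀} (7281 (dist p₀ y)⁻¹⁴ + 521 (dist p₀ y)⁻⁸)` of `…Flatness`: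

* `tsum_U_probe_eq` — the `U`-FIELD OF THE CAVITY AT A PROBE, exactly: for `w ∉ P`,
  `Σ'_{y≠p₀} U(dist w y) = Σ'_{y≠p₀}[(V−g)(dist w y) − (V−g)(dist p₀ y)] − (f 0 − f(dist w p₀))`
  (invisibility at `w` with `f = V − g − U` termwise, and `f 0 = −Σ'(V−g)(dist p₀ y)`);
* `tsum_U_probe_le` — hence `Σ'_{y≠p₀} U(dist w y) ≤ ΔE_V(p₀ ↦ w)` (`|f| ≤ f 0`, single-site stability);
* `U_dist_le_mul_sq` — symmetrising over `p₀ ± u` and using `lennardJones_secondDiff_le`: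
  `U(dist (p₀ + u) y) ≤ 2K ‖u‖²` for every `y ∈ P ∖ {p₀}` and `0 < ‖u‖ ≤ ρ₁/4`;
* `U_le_mul_sq_near_templateDist` — **for every template distance `d = dist p₀ q` (also those INSIDE the core,
  `d < ρ`) and `|t| ≤ ρ₁/4`: `U(d + t) ≤ 2K t²`** — a quadratic squeeze of the slack with ONE constant for all
  shells (the sibling's `Contact.stub_tangency` needs `d > ρ` and a shell-dependent constant; here the
  displacement is a single site, not a dilation).  Consequently `g + f` is tangent to `V` at every template
  distance, and beyond the range `f` is (`U_le…` with `g = 0`).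
* `slackSqueeze_of_clauses` — registered sub-goal, crux conjuncts 2–7 verbatim as hypotheses.

All `[folklore]`.
-/

noncomputable section

namespace Summit.AtomisticToContinuum.Crystallization.Theorems.BraggSlacknessRigidityStrictCertificate

open Literature.MathematicalPhysics.StatisticalMechanics
open Summit.AtomisticToContinuum.Crystallization.Theorems.ExactCertificateNegative (IsSplit)
open Summit.AtomisticToContinuum.Crystallization.Theorems.ChargedEnergyGapNegative (E3)
open Summit.AtomisticToContinuum.Crystallization.Theorems.ThreeConeCertificateExactCertificate.Slackness
  (summable_of_finRange)
open scoped BigOperators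

/-! ## The `U`-field of the cavity at a probe -/

/-- **The `U`-field of the cavity at a probe is summable and given exactly by**
`Σ'_{y≠p₀} U(dist w y) = Σ'_{y≠p₀}[(V−g)(dist w y) − (V−g)(dist p₀ y)] − (f 0 − f(dist w p₀))`. [folklore] -/
theorem tsum_U_probe_eq {P : PeriodicConfiguration 3} {ρ c : ℝ} {g U f : ℝ → ℝ}
    (h : IsSplit ρ c g U f) (hv : c + f 0 / 2 ≤ -(P.energyPerParticle lennardJones))
    {p₀ w : E3} (hp₀ : p₀ ∈ P.points) (hw : w ∉ P.points) :
    (Summable fun q : {q : E3 // q ∈ P.points ∧ q ≠ p₀} => U (dist w q.1)) ∧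
    ∑' q : {q : E3 // q ∈ P.points ∧ q ≠ p₀}, U (dist w q.1) =
      (∑' q : {q : E3 // q ∈ P.points ∧ q ≠ p₀},
        ((lennardJones (dist w q.1) - g (dist w q.1)) - (lennardJones (dist p₀ q.1) - g (dist p₀ q.1))))
      - (f 0 - f (dist w p₀)) := by
  obtain ⟨hsf, hzero⟩ := f_dist_probe_add_tsum_eq_zero h hv hp₀ (w := w)
  have hsVg := summable_cavity_probe P h (p₀ := p₀) hw
  -- termwise `U = (V − g) − f` at the (positive) distances from the probe
  have hterm : ∀ q : {q : E3 // q ∈ P.points ∧ q ≠ p₀},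
      U (dist w q.1) = (lennardJones (dist w q.1) - g (dist w q.1)) - f (dist w q.1) := by
    intro q
    have hd : 0 < dist w q.1 := dist_pos.2 fun heq => hw (heq ▸ q.2.1)
    have h1 := h.split _ hd
    linarith
  have hsU : Summable fun q : {q : E3 // q ∈ P.points ∧ q ≠ p₀} => U (dist w q.1) :=
    (hsVg.sub hsf).congr fun q => (hterm q).symm
  refine ⟨hsU, ?_⟩
  rw [tsum_congr hterm, hsVg.tsum_sub hsf, (summable_cavity_probe P h hw).tsum_sub
    (summable_cavity_site P h p₀), f_zero_eq_neg_tsum_cavity h hv hp₀]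
  linarith

/-- **The `U`-field of the cavity at a probe is dominated by the Lennard-Jones cavity excess**:
`Σ'_{y≠p₀} U(dist w y) ≤ Σ'_{y≠p₀}[V(dist w y) − V(dist p₀ y)]` (`f ≤ f 0`, single-site stability of `g`).
[folklore] -/
theorem tsum_U_probe_le {P : PeriodicConfiguration 3} {ρ c : ℝ} {g U f : ℝ → ℝ}
    (h : IsSplit ρ c g U f) (hv : c + f 0 / 2 ≤ -(P.energyPerParticle lennardJones))
    {p₀ w : E3} (hp₀ : p₀ ∈ P.points) (hw : w ∉ P.points) :
    ∑' q : {q : E3 // q ∈ P.points ∧ q ≠ p₀}, U (dist w q.1) ≤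
      ∑' q : {q : E3 // q ∈ P.points ∧ q ≠ p₀},
        (lennardJones (dist w q.1) - lennardJones (dist p₀ q.1)) := by
  obtain ⟨-, heq⟩ := tsum_U_probe_eq h hv hp₀ hw
  have hN : 0 ≤ f 0 - f (dist w p₀) := sub_nonneg.2 ((le_abs_self _).trans (h.abs_f_le dist_nonneg))
  have hg := singleSite_stability_of_isSplit h hv hp₀ hw
  have hV := (summable_lennardJones_probe P (p₀ := p₀) hw).sub (P.summable_lennardJones_dist_three p₀)
  have hgs := (summable_finRange_probe P h.g_zero (p₀ := p₀) hw).sub (summable_of_finRange P h.g_zero p₀)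
  have hsplit : (∑' q : {q : E3 // q ∈ P.points ∧ q ≠ p₀},
      ((lennardJones (dist w q.1) - g (dist w q.1)) - (lennardJones (dist p₀ q.1) - g (dist p₀ q.1)))) =
      (∑' q : {q : E3 // q ∈ P.points ∧ q ≠ p₀}, (lennardJones (dist w q.1) - lennardJones (dist p₀ q.1)))
      - ∑' q : {q : E3 // q ∈ P.points ∧ q ≠ p₀}, (g (dist w q.1) - g (dist p₀ q.1)) := by
    rw [← hV.tsum_sub hgs]
    exact tsum_congr fun q => by ring
  rw [heq, hsplit]
  linarith

/-! ## The uniform quadratic squeeze -/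

/-- **Every single value of the slack near a shell is quadratically small**: for `y ∈ P ∖ {p₀}` and a
displacement `u ≠ 0` with `‖u‖ ≤ ρ₁/4`, `U(dist (p₀ + u) y) ≤ ‖u‖² · Σ'_{q≠p₀}(7281 (dist p₀ q)⁻¹⁴ + 521 (dist p₀ q)⁻⁸)`
(symmetrise `tsum_U_probe_le` over `±u`, drop all other non-negative terms, `lennardJones_secondDiff_le`).
[folklore] -/
theorem U_dist_le_mul_sq {P : PeriodicConfiguration 3} {ρ c : ℝ} {g U f : ℝ → ℝ}
    (h : IsSplit ρ c g U f) (hv : c + f 0 / 2 ≤ -(P.energyPerParticle lennardJones))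
    {p₀ : E3} (hp₀ : p₀ ∈ P.points) {ρ₁ : ℝ} (hρ₁ : 0 < ρ₁)
    (hsep : ∀ q ∈ P.points, q ≠ p₀ → ρ₁ ≤ dist p₀ q) {u : E3} (hu0 : u ≠ 0) (hu : ‖u‖ ≤ ρ₁ / 4)
    (y : {q : E3 // q ∈ P.points ∧ q ≠ p₀}) :
    U (dist (p₀ + u) y.1) ≤ ‖u‖ ^ 2 * ∑' q : {q : E3 // q ∈ P.points ∧ q ≠ p₀},
      (7281 * (dist p₀ q.1)⁻¹ ^ 14 + 521 * (dist p₀ q.1)⁻¹ ^ 8) := by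
  have hlt : ‖u‖ < ρ₁ := by linarith
  have hup : p₀ + u ∉ P.points :=
    not_mem_points_of_dist_lt P hsep (by rwa [dist_self_add_right]) (by simpa using hu0)
  have hum : p₀ - u ∉ P.points :=
    not_mem_points_of_dist_lt P hsep (by rwa [dist_self_sub_right]) (by simpa using hu0)
  -- the two `U`-fields and their Lennard-Jones bounds
  obtain ⟨hsp, -⟩ := tsum_U_probe_eq h hv hp₀ hup
  obtain ⟨hsm, -⟩ := tsum_U_probe_eq h hv hp₀ hum
  have hlep := tsum_U_probe_le h hv hp₀ hup
  have hlem := tsum_U_probe_le h hv hp₀ hum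
  -- the term `y` of the `+u` field is bounded by the whole field (all terms are `≥ 0`)
  have hUnn : ∀ (w : E3), w ∉ P.points → ∀ q : {q : E3 // q ∈ P.points ∧ q ≠ p₀}, 0 ≤ U (dist w q.1) :=
    fun w hw q => h.U_nonneg _ (dist_pos.2 fun heq => hw (heq ▸ q.2.1))
  have hy : U (dist (p₀ + u) y.1) ≤ ∑' q : {q : E3 // q ∈ P.points ∧ q ≠ p₀}, U (dist (p₀ + u) q.1) :=
    hsp.le_tsum y fun q _ => hUnn _ hup q
  have hm0 : 0 ≤ ∑' q : {q : E3 // q ∈ P.points ∧ q ≠ p₀}, U (dist (p₀ - u) q.1) :=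
    tsum_nonneg fun q => hUnn _ hum q
  -- the symmetrised Lennard-Jones excess is `O(‖u‖²)`
  have hterm : ∀ q : {q : E3 // q ∈ P.points ∧ q ≠ p₀},
      (lennardJones (dist (p₀ + u) q.1) - lennardJones (dist p₀ q.1))
        + (lennardJones (dist (p₀ - u) q.1) - lennardJones (dist p₀ q.1)) ≤
      ‖u‖ ^ 2 * (7281 * (dist p₀ q.1)⁻¹ ^ 14 + 521 * (dist p₀ q.1)⁻¹ ^ 8) := by
    intro q
    have hvq : p₀ - q.1 ≠ 0 := sub_ne_zero.2 fun heq => q.2.2 heq.symm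
    have e1 : dist (p₀ + u) q.1 = ‖(p₀ - q.1) + u‖ := by rw [dist_eq_norm]; congr 1; abel
    have e2 : dist (p₀ - u) q.1 = ‖(p₀ - q.1) - u‖ := by rw [dist_eq_norm]; congr 1; abel
    have e3 : dist p₀ q.1 = ‖p₀ - q.1‖ := dist_eq_norm _ _
    have hu' : ‖u‖ ≤ ‖p₀ - q.1‖ / 4 := by
      have h4 := hsep q.1 q.2.1 q.2.2
      rw [e3] at h4
      linarith
    have key := lennardJones_secondDiff_le hvq hu'
    rw [(inv_sq_pow_eq ‖p₀ - q.1‖).1, (inv_sq_pow_eq ‖p₀ - q.1‖).2] at key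
    rw [e1, e2, e3]
    linarith
  have hs1 := summable_lennardJones_cavity_excess P (p₀ := p₀) hup
  have hs2 := summable_lennardJones_cavity_excess P (p₀ := p₀) hum
  have hs14 := P.summable_inv_pow_dist (n := 14) (by norm_num) p₀
  have hs8 := P.summable_inv_pow_dist (n := 8) (by norm_num) p₀
  have hsR : Summable fun q : {q : E3 // q ∈ P.points ∧ q ≠ p₀} =>
      ‖u‖ ^ 2 * (7281 * (dist p₀ q.1)⁻¹ ^ 14 + 521 * (dist p₀ q.1)⁻¹ ^ 8) :=
    ((hs14.mul_left 7281).add (hs8.mul_left 521)).mul_left _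
  have hle := (hs1.add hs2).tsum_le_tsum hterm hsR
  rw [hs1.tsum_add hs2, tsum_mul_left] at hle
  linarith

/-- **UNIFORM QUADRATIC SQUEEZE OF THE SLACK AT EVERY TEMPLATE DISTANCE.**  For a witness, a site `p₀ ∈ P`
with nearest-neighbour distance `ρ₁ > 0`, any other point `q ∈ P` (so `d = dist p₀ q` is a template
distance, possibly `< ρ`) and `|t| ≤ ρ₁/4`:
`U(d + t) ≤ t² · Σ'_{y≠p₀}(7281 (dist p₀ y)⁻¹⁴ + 521 (dist p₀ y)⁻⁸)` (move `p₀` by `t` along the line to `q`).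
[folklore] -/
theorem U_le_mul_sq_near_templateDist {P : PeriodicConfiguration 3} {ρ c : ℝ} {g U f : ℝ → ℝ}
    (h : IsSplit ρ c g U f) (hv : c + f 0 / 2 ≤ -(P.energyPerParticle lennardJones))
    {p₀ : E3} (hp₀ : p₀ ∈ P.points) {ρ₁ : ℝ} (hρ₁ : 0 < ρ₁)
    (hsep : ∀ q ∈ P.points, q ≠ p₀ → ρ₁ ≤ dist p₀ q) {q : E3} (hq : q ∈ P.points) (hne : q ≠ p₀)
    {t : ℝ} (ht : |t| ≤ ρ₁ / 4) :
    U (dist p₀ q + t) ≤ t ^ 2 * ∑' y : {y : E3 // y ∈ P.points ∧ y ≠ p₀},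
      (7281 * (dist p₀ y.1)⁻¹ ^ 14 + 521 * (dist p₀ y.1)⁻¹ ^ 8) := by
  rcases eq_or_ne t 0 with rfl | ht0
  · -- `U(d) = 0` on the distance set
    have hU := Summit.AtomisticToContinuum.Crystallization.Theorems.ThreeConeCertificateExactCertificate.Slackness.U_eq_zero_of_mem_points
      h hv hp₀ hq hne.symm
    simp [hU]
  · set d : ℝ := dist p₀ q with hd
    have hdpos : 0 < d := by rw [hd]; exact dist_pos.2 hne.symm
    have hρd : ρ₁ ≤ d := hsep q hq hne
    -- the displacement `u = (t/d) • (p₀ − q)`, of norm `|t|`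
    set u : E3 := (t / d) • (p₀ - q) with hudef
    have hnpq : ‖p₀ - q‖ = d := by rw [hd, dist_eq_norm]
    have hnu : ‖u‖ = |t| := by
      rw [hudef, norm_smul, hnpq, Real.norm_eq_abs, abs_div, abs_of_pos hdpos, div_mul_cancel₀ _ hdpos.ne']
    have hu0 : u ≠ 0 := by
      rw [← norm_ne_zero_iff, hnu]
      exact abs_ne_zero.2 ht0
    have key := U_dist_le_mul_sq h hv hp₀ hρ₁ hsep hu0 (by rw [hnu]; exact ht) ⟨q, hq, hne⟩
    -- `dist (p₀ + u) q = d + t`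
    have hdist : dist (p₀ + u) q = d + t := by
      have e1 : p₀ + u - q = (1 + t / d) • (p₀ - q) := by
        rw [hudef, add_smul, one_smul]
        abel
      have hcoef : 0 ≤ 1 + t / d := by
        have h1 : |t| ≤ d := by linarith
        have h2 : -d ≤ t := by linarith [neg_abs_le t]
        have h3 : -1 ≤ t / d := by rw [le_div_iff₀ hdpos]; linarith
        linarith
      rw [dist_eq_norm, e1, norm_smul, Real.norm_of_nonneg hcoef, hnpq]
      field_simp
    rw [hdist, hnu, sq_abs] at key
    exact key

/-- **Registered sub-goal `slackSqueeze_of_clauses`** (crux conjuncts 2–7 verbatim as hypotheses): for every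
witness of `StrictCertificate` (indeed of `ExactCertificate`) and every site `p₀` there are `C` and `δ > 0` with
`U(dist p₀ q + t) ≤ C t²` for every other point `q ∈ P` and `|t| ≤ δ`. [folklore] -/
theorem slackSqueeze_of_clauses : ∀ (P : Literature.MathematicalPhysics.StatisticalMechanics.PeriodicConfiguration 3) (ρ c : ℝ) (g U f : ℝ → ℝ), (∀ r : ℝ, 0 < r → Literature.MathematicalPhysics.StatisticalMechanics.lennardJones r = g r + U r + f r) → (∀ r : ℝ, 0 < r → 0 ≤ U r) → (∀ r : ℝ, ρ ≤ r → g r = 0) → (∀ (n : ℕ) (y : Fin n → EuclideanSpace ℝ (Fin 3)) (w : Fin n → ℝ), 0 ≤ ∑ i, ∑ j, w i * w j * f (dist (y i) (y j))) → (∀ (N : ℕ) (x : Fin N → EuclideanSpace ℝ (Fin 3)), Function.Injective x → -(c * (N : ℝ)) ≤ Literature.MathematicalPhysics.StatisticalMechanics.interactionEnergy g x) → c + f 0 / 2 = -(P.energyPerParticle Literature.MathematicalPhysics.StatisticalMechanics.lennardJones) → ∀ p₀ ∈ P.points, ∃ C δ : ℝ, 0 < δ ∧ ∀ q ∈ P.points,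 q ≠ p₀ → ∀ t : ℝ, |t| ≤ δ → U (dist p₀ q + t) ≤ C * t ^ 2 := by
  intro P ρ c g U f h1 h2 h3 h4 h5 h6 p₀ hp₀
  obtain ⟨ρ₁, hρ₁, hsep⟩ :=
    Summit.AtomisticToContinuum.Crystallization.Theorems.PhononSlackCertificatesNearFarGlueR.periodicInsertion_exists_pos_le_dist
      P hp₀
  refine ⟨∑' y : {y : E3 // y ∈ P.points ∧ y ≠ p₀}, (7281 * (dist p₀ y.1)⁻¹ ^ 14 + 521 * (dist p₀ y.1)⁻¹ ^ 8),
    ρ₁ / 4, by linarith, fun q hq hne t ht => ?_⟩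
  have key := U_le_mul_sq_near_templateDist ⟨h1, h2, h3, h4, h5⟩ h6.le hp₀ hρ₁
    (fun q' hq' hne' => hsep q' hq' hne') hq hne ht
  linarith [key]

end Summit.AtomisticToContinuum.Crystallization.Theorems.BraggSlacknessRigidityStrictCertificate

end
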